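/-
Copyright: lit-balaban Phase-2 proof seat p30 (gen 29).  Statement-level skeleton of a published paper; no proof claims beyond what
the kernel checks below.
-/
import Literature.MathematicalPhysics.QuantumFieldTheory.BalabanImbrieJaffe1984to88.BIJ88NeumannPropagatorSmallFieldCloseAllRows
import Literature.MathematicalPhysics.QuantumFieldTheory.BalabanImbrieJaffe1984to88.BIJ88NeumannPropagatorSmallFieldRegionDeriv

/-!
# [BalabanImbrieJaffe1985] §7.3 p. 326 ⟵ [Balaban1983RegularityDecay] Theorem p. 573, (1.11)–(1.12): **THE `δG_k(□, Ω)` VALUE AND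
# COVARIANT-DERIVATIVE MEMBERS FOR GENERAL NESTED `k`-BLOCK UNIONS `□ ⊆ Ω` AT SMALL-PLAQUETTE `U(1)` FIELDS, HYPOTHESIS-FREE**
# (the four (H1.10″) inputs of gens 27–29 discharged by p34's region members; value member at every row, covariant derivative at the rows
# whose open `L^k`-ball lies in `□`; + the packaged inputs `inputs110_smallPlaquette_region` and the consumer shape `hC` for a cube family
# inside a general block union)

T. Bałaban, J. Imbrie, A. Jaffe, *Renormalization of the Higgs model: minimizers, propagators and the stability of mean field theory*,
Commun. Math. Phys. **97** (1985) 299–329 [BalabanImbrieJaffe1985], row **C1.Eq7.3.1-7.3.2** (owner r15) / front **C2S14** (owner r18,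
rows C2.Eq2.31 / C2.Claim@263 / C2.Eq2.27: the `(H1.12)` input of p31's `(2.31)_k ⟸ (1.10)–(1.12)` chain, now for a GENERAL region `Ω`);
[7] = T. Bałaban, *Regularity and decay of lattice Green's functions*, Commun. Math. Phys. **89** (1983) 571–597 [Balaban1983RegularityDecay].

statement-level skeleton of published theorems with citation tags; proofs where landed; nothing here is a claim about the Yang–Mills mass gap

PDF held and re-read this session: `paper:balaban1983-cmp89-regularity-decay` p. 572 l. 12 *"We consider subsets Ω which are unions of big
blocks"* and p. 573 = PDF 3, the Theorem (quoted in full in the sibling `BIJ88NeumannPropagatorSmallFieldCloseAllRows`): *"… If Ω ⊂ Ω₀,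
then for δG_k(Ω,Ω₀,A) defined by the equality δG_k(Ω,Ω₀,A) = G_k(Ω,A) − G_k(Ω₀,A), (1.11) we have the inequalities (1.5) and (1.6) (with
the same restrictions on x, x′) with the additional factor (1.12) on the right hand sides."*; `paper:balaban1985-cmp97-bij-higgs-minimizers`
p. 326 = PDF 28, lines 18–22: *"The propagators arising from Δ_k(u_k), under the restriction (7.3.1) on the gauge field, also satisfy the
regularity and decay estimates of [7]."*; `paper:balaban1988-cmp114-bij-abelian-higgs-effective-action` p. 263 = PDF 7, lines 16–20,
(2.31) VERBATIM: *"|(G_{k,loc}(u)f − G_k(Ω, u)f)(x)| ≦ e^{−cr(e_k)}e^{−c dist(suppt f, x)}‖f‖_∞, (2.31) for dist(x, Ω^c) ≧ O(r(e_k)). [Each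
G_k(□_α, u) is close to G_k(Ω, u) for the relevant x₁, x₂, therefore the convex combination and G_{k,loc} are close also.] We assume that u
is smooth in the □_α's entering the sum in (2.27); for (2.31) we assume smoothness throughout the subset Ω ⊂ T_η."*  READING (ours, NOT a
quotation): `Ω` = a union of `k`-blocks of the torus containing the cubes `□_α` of (2.27) — the tree's `IsBlockUnion k Ω` with `□_α ⊆ Ω`.
v1.0.1 (DOCSTRING-ONLY; referee-5 g70 finding D-g70-2 served): v1.0 of this header presented a kernel-form gloss of (2.31) together with this
reading inside quotation marks; only genuinely verbatim text is now quoted.  Lean declarations unchanged (byte-identical bodies).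

WHAT THIS FILE PROVES (objects: p31's region Neumann propagators `G_k(X,u) = gBox (α_kL^{kd}) ε⁻¹ u k X` on the fine torus, `X` a union of
`k`-blocks (`IsBlockUnion`), `T(x,y) = |x − y|_∞` the sup torus distance in fine units = `B5Ineq137Torus.T P 0`; the block-scale
plaquette threshold `((L^k)²θ)² ≤ 1/500` of p31's `BIJ88DeltaLocSmallPlaquetteTorusCwt`):
* §2 **`inputs110_smallPlaquette_region`** — THE FOUR (H1.10″) INPUTS PACKAGED ONCE (p27's request 2026-08-23T07:33Z, shape of p27's
  `inputs110_smallPlaquette_cube_torus` with the cube data replaced by `∀ □ Ω, IsBlockUnion k □ → IsBlockUnion k Ω → □ ⊆ Ω →`): for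
  `1 ≤ d`, `d + 1 ≤ 3`, `ℓ ≥ 1` with `ℓ + 1` odd, `a > 0` there are `c₀ ≥ 0`, `δ₀ > 0` such that for every volume (`P.d = d + 1`,
  `P.L = ℓ + 1`), every `1 ≤ k ≤ K` with `2(L^k − 1) + 4 < |T|`, every `u` with `‖u(∂p) − 1‖ ≤ θ`, `0 ≤ θ`, `((L^k)²θ)² ≤ 1/500`, all nested
  `k`-block unions `□ ⊆ Ω`:  `2d³((L^k)²θ)² ≤ 1` ∧ `hGB` ∧ `hGΩ` ∧ `hDB` ∧ `hDΩ` in EXACTLY the hypothesis shapes of gen 28's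
  `close112_smallField_deriv_of_inputs` — p34's `decay110_smallPlaquette_region_uniform` (value, every row) and
  `decay110_smallPlaquette_region_deriv_uniform_input` (covariant derivative, rows whose open `L^k`-ball lies in the region) BY NAME, each
  used twice (for `□` and for `Ω`), at the common constants `(max, min)`;
* §3 **`close112_smallPlaquette_region`** — the VALUE member of (1.11)–(1.12), HYPOTHESIS-FREE, for all nested `k`-block unions `□ ⊆ Ω`,
  EVERY row `x ∈ □`, every `f` supported in `□`:
  `‖(G_k(□,u)f)(x) − (G_k(Ω,u)f)(x)‖ ≤ (L^kε)²·c e^{−δD/L^k}e^{−δ(D_b + D_f)/L^k}·F`  (sibling's `close112_smallField_of_inputs_allRows` ∘ §2);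
* §4 **`close112_smallPlaquette_region_deriv`** — the COVARIANT-DERIVATIVE member, HYPOTHESIS-FREE, same data, rows `x ∈ □` with
  `L^k ≤ T(x, w)` for all `w ∉ □`, every `μ`:
  `‖covD ε⁻¹ u (G_k(□,u)f)⟨x,μ⟩ − covD ε⁻¹ u (G_k(Ω,u)f)⟨x,μ⟩‖ ≤ (L^kε)·c e^{−δD/L^k}e^{−δ(D_b + D_f)/L^k}·F`
  (sibling's `close112_smallField_deriv_of_inputs_ballRows` ∘ §2);
* §5 **`close112_smallPlaquette_region_hC`** — HYPOTHESIS-FREE hypothesis `hC` of p31's `BIJ88DeltaLocClose235General.opClose231_gen` for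
  ANY family of `k`-block unions `□_α ⊆ Ω` inside ANY `k`-block union `Ω` (our reading of the (2.31) situation, print p. 263: *"for (2.31)
  we assume smoothness throughout the subset Ω ⊂ T_η"*), row sets `X_α := □_α`, together with the matching `hGΩ` (p34's value member at
  every row of `Ω`).

METHOD (ours).  Pure instantiation: §2 aligns the two providers' constants by `max`/`min` (sibling's `mono_bound`-type monotonicity) and
derives their `(T, ½)`-thresholds from `((L^k)²θ)² ≤ 1/500` by the threshold arithmetic of p31's `smallness_of_threshold` (private copy); §§3–5 feed §2 into the sibling's
all-rows / ball-rows theorems.  No analysis is redone here.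

HONEST SCOPE.  (i) `U(1)` only; `2 ≤ d′ = d + 1 ≤ 3`; `L = ℓ + 1` odd `≥ 3` (p34's members want `L > 1` odd); `1 ≤ k ≤ K`; block-scale
plaquette smallness `((L^k)²θ)² ≤ 1/500` (stronger than (7.3.1)'s `e(ε)`-type smallness at large `L^{2k}`; that the induction's backgrounds
meet it is p33's lane).  (ii) `□ ⊆ Ω` arbitrary nested unions of `k`-blocks (`IsBlockUnion`) — more general than the print's unions of big
blocks; the torus `Ω = T` is the block union `univ`.  (iii) Value member at every row; covariant-derivative member only at rows whose open
`L^k`-ball lies in `□` (the domain of p34's `D` member); the Hölder member of the clause is p27's `BIJ88NeumannPropagatorSmallFieldCloseHolder`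
/ `…CloseHolderRegion` lane and is not touched.  (iv) Constants depend on `(d, L, a)` only, explicit in the providers; no optimisation.
DIVERGENCE OF METHOD from [7]'s random-walk expansion as disclosed in gens 25–28 and in p27/p34's member files (Kato/Agmon/Nash route).
Kernel lemmas tagged [folklore] are real arithmetic.  Nothing here is summit progress.  Unit `lit-balaban-p30`
(literature-prover-lit-balaban-p30-g29-0), HOME `run/shared/lean/pub/lit-balaban/`, 2026-08-23.
-/

open scoped BigOperators ComplexConjugate
open Finset Matrix

namespace Literature.MathematicalPhysics.QuantumFieldTheory.BalabanImbrieJaffe1984to88.BIJ88NeumannPropagatorSmallFieldCloseRegion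

open Literature.MathematicalPhysics.QuantumFieldTheory.Balaban1983to89
open LatticeFieldCalculus (supDist)
open BIJ88Sect3Statements (U1 toC cfg covD norm_toC)
open BIJ85AbelianStokes (plaqC plaqC_eq_toC_plaqHol)
open BIJ88NeumannNoZeroModesTorus (IsBlockUnion)
open BIJ88NeumannPropagator227Torus (gBox)
open BIJ88NeumannPropagatorSmallFieldRegionSup (decay110_smallPlaquette_region_uniform)
open BIJ88NeumannPropagatorSmallFieldRegionDeriv (decay110_smallPlaquette_region_deriv_uniform_input)
open BIJ88NeumannPropagatorSmallFieldCloseAllRows (close112_smallField_of_inputs_allRows close112_smallField_deriv_of_inputs_ballRows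
  close112_smallField_hC_allRows)

noncomputable section

variable {P : Params}

/-! ## §1 Kernel lemmas (private): monotonicity in the constants, the threshold arithmetic -/

/-- kernel: weakening the constants of a one-factor decay bound, `c ≤ c′`, `δ′ ≤ δ`, `E, F ≥ 0`: `c·e^{−δE}·F ≤ c′·e^{−δ′E}·F`. [folklore] -/
private theorem mono_bound {c c' δ δ' E F : ℝ} (hc : 0 ≤ c) (hcc : c ≤ c') (hδ : δ' ≤ δ) (hE : 0 ≤ E) (hF : 0 ≤ F) :
    c * Real.exp (-(δ * E)) * F ≤ c' * Real.exp (-(δ' * E)) * F :=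
  mul_le_mul_of_nonneg_right (mul_le_mul hcc (Real.exp_le_exp.2 (neg_le_neg (mul_le_mul_of_nonneg_right hδ hE))) (Real.exp_pos _).le
    (hc.trans hcc)) hF

/-- kernel (the arithmetic of p31's `BIJ88DeltaLocSmallPlaquetteTorusCwt.smallness_of_threshold` — the statement of record — repeated
PRIVATELY to keep this propagator-level file below the (2.30)–(2.41) chain in the import order, as in gen 28 and in the sibling): the
block-scale plaquette threshold `(L^{2k}θ)² ≤ 1/500` implies, for `1 ≤ d′ ≤ 3`, `2d′³(L^{2k}θ)² ≤ 1` and, with `T = (d′−1)(L^k−1)θ`,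
`2(L^k−1)L^k·d′·T² + 2(d′(L^k−1)T)² ≤ ½`. [cite: BalabanImbrieJaffe1985, (7.3.1) p.326] -/
private theorem threshold_smallness {dr n θ : ℝ} (hd1 : 1 ≤ dr) (hd3 : dr ≤ 3) (hn : 1 ≤ n) (hθ : 0 ≤ θ)
    (hτ : (n ^ 2 * θ) ^ 2 ≤ 1 / 500) :
    2 * dr ^ 3 * (n ^ 2 * θ) ^ 2 ≤ 1 ∧
      2 * ((n - 1) * n) * dr * ((dr - 1) * (n - 1) * θ) ^ 2 + 2 * (dr * (n - 1) * ((dr - 1) * (n - 1) * θ)) ^ 2 ≤ 1 / 2 := by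
  have hd0 : 0 ≤ dr := by linarith
  have hn0 : 0 ≤ n := by linarith
  have hd27 : dr ^ 3 ≤ 27 := by
    have h := pow_le_pow_left₀ hd0 hd3 3
    norm_num at h
    exact h
  have hd81 : dr ^ 4 ≤ 81 := by
    have h := pow_le_pow_left₀ hd0 hd3 4
    norm_num at h
    exact h
  have hτ0 : 0 ≤ (n ^ 2 * θ) ^ 2 := sq_nonneg _
  refine ⟨?_, ?_⟩
  · calc 2 * dr ^ 3 * (n ^ 2 * θ) ^ 2 ≤ 2 * 27 * (1 / 500) :=
          mul_le_mul (mul_le_mul_of_nonneg_left hd27 (by norm_num)) hτ hτ0 (by norm_num)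
      _ ≤ 1 := by norm_num
  · have hn1 : n - 1 ≤ n := by linarith
    have hdr1 : dr - 1 ≤ dr := by linarith
    have hn10 : 0 ≤ n - 1 := by linarith
    have hdr10 : 0 ≤ dr - 1 := by linarith
    calc 2 * ((n - 1) * n) * dr * ((dr - 1) * (n - 1) * θ) ^ 2 + 2 * (dr * (n - 1) * ((dr - 1) * (n - 1) * θ)) ^ 2
        ≤ 2 * (n * n) * dr * (dr * n * θ) ^ 2 + 2 * (dr * n * (dr * n * θ)) ^ 2 := by gcongr
      _ = (2 * dr ^ 3 + 2 * dr ^ 4) * (n ^ 2 * θ) ^ 2 := by ring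
      _ ≤ (2 * 27 + 2 * 81) * (1 / 500) := mul_le_mul (by linarith) hτ hτ0 (by norm_num)
      _ ≤ 1 / 2 := by norm_num

/-! ## §2 The four (H1.10″) inputs for nested block unions, packaged once -/

/-- **THE FOUR (H1.10″) INPUTS OF THE (1.11)–(1.12) CLAUSE FOR GENERAL NESTED `k`-BLOCK UNIONS `□ ⊆ Ω` AT A SMALL-PLAQUETTE `U(1)` FIELD,
PACKAGED ONCE** (p34's `decay110_smallPlaquette_region_uniform` and `decay110_smallPlaquette_region_deriv_uniform_input` BY NAME, each for `□`
and for `Ω`, at the common constants): for `1 ≤ d`, `d + 1 ≤ 3`, `ℓ ≥ 1` with `ℓ + 1` odd, `a > 0` there are `c₀ ≥ 0`, `δ₀ > 0` such that for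
every volume (`P.d = d + 1`, `P.L = ℓ + 1`), every `1 ≤ k ≤ K` with `2(L^k − 1) + 4 < |T|`, every `u` with `‖u(∂p) − 1‖ ≤ θ`, `0 ≤ θ`,
`((L^k)²θ)² ≤ 1/500`, and all nested `k`-block unions `□ ⊆ Ω`: `2d³((L^k)²θ)² ≤ 1`, and (hGB) `‖(G_k(□,u)f)(x)‖ ≤ (L^kε)²c₀e^{−δ₀D/L^k}F`,
(hGΩ) the same for `G_k(Ω,u)`, at every `x ∈ □`; (hDB) `‖covD ε⁻¹ u (G_k(□,u)f)⟨x,μ⟩‖ ≤ (L^kε)c₀e^{−δ₀D/L^k}F`, (hDΩ) the same for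
`G_k(Ω,u)`, at every `x` with `{T(x,·) < L^k} ⊆ □` — literally the hypotheses of gen 28's `close112_smallField_deriv_of_inputs`.
[cite: Balaban1983RegularityDecay, Theorem p.573 (1.10)] [cite: BalabanImbrieJaffe1985, (7.3.1) p.326] -/
theorem inputs110_smallPlaquette_region (d ℓ : ℕ) (hd1 : 1 ≤ d) (hd3 : d + 1 ≤ 3) (hℓ : 1 ≤ ℓ) (hodd : Odd (ℓ + 1)) {a : ℝ} (ha : 0 < a) :
    ∃ c₀ δ₀ : ℝ, 0 ≤ c₀ ∧ 0 < δ₀ ∧ ∀ (P : Params), P.d = d + 1 → P.L = ℓ + 1 →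
      ∀ k : ℕ, 1 ≤ k → k ≤ P.K → 2 * (P.L ^ k - 1) + 4 < P.sitesPerDir 0 →
      ∀ (U : GaugeField P 0 U1) (θ : ℝ), 0 ≤ θ → (∀ (y : Balaban1983to89.Site P 0) (μ ν : Fin P.d), ‖plaqC U y μ ν - 1‖ ≤ θ) →
        (((P.L : ℝ) ^ k) ^ 2 * θ) ^ 2 ≤ 1 / 500 →
      ∀ (B Ω : Finset (Balaban1983to89.Site P 0)), IsBlockUnion k B → IsBlockUnion k Ω → B ⊆ Ω →
      2 * (P.d : ℝ) ^ 3 * (((P.L : ℝ) ^ k) ^ 2 * θ) ^ 2 ≤ 1 ∧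
      (∀ x ∈ B, ∀ (f : Balaban1983to89.Site P 0 → ℂ) (F D : ℝ), (∀ y, ‖f y‖ ≤ F) → 0 ≤ D →
          (∀ y, f y ≠ 0 → D ≤ B5Ineq137Torus.T P 0 x y) →
          ‖(gBox (B1RG242Torus.α P a k * (P.L : ℝ) ^ (k * P.d)) P.eps⁻¹ U k B *ᵥ f) x‖ ≤
            P.spacing k ^ 2 * (c₀ * Real.exp (-(δ₀ * (((P.L : ℝ) ^ k)⁻¹ * D))) * F)) ∧
      (∀ x ∈ B, ∀ (f : Balaban1983to89.Site P 0 → ℂ) (F D : ℝ), (∀ y, ‖f y‖ ≤ F) → 0 ≤ D →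
          (∀ y, f y ≠ 0 → D ≤ B5Ineq137Torus.T P 0 x y) →
          ‖(gBox (B1RG242Torus.α P a k * (P.L : ℝ) ^ (k * P.d)) P.eps⁻¹ U k Ω *ᵥ f) x‖ ≤
            P.spacing k ^ 2 * (c₀ * Real.exp (-(δ₀ * (((P.L : ℝ) ^ k)⁻¹ * D))) * F)) ∧
      (∀ x, (∀ y, B5Ineq137Torus.T P 0 x y < (P.L : ℝ) ^ k → y ∈ B) →
          ∀ (f : Balaban1983to89.Site P 0 → ℂ) (F D : ℝ), (∀ y, ‖f y‖ ≤ F) → 0 ≤ D →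
          (∀ y, f y ≠ 0 → D ≤ B5Ineq137Torus.T P 0 x y) → ∀ (μ : Fin P.d),
          ‖covD P.eps⁻¹ (cfg U) (gBox (B1RG242Torus.α P a k * (P.L : ℝ) ^ (k * P.d)) P.eps⁻¹ U k B *ᵥ f) ⟨x, μ⟩‖ ≤
            P.spacing k * (c₀ * Real.exp (-(δ₀ * (((P.L : ℝ) ^ k)⁻¹ * D))) * F)) ∧
      (∀ x, (∀ y, B5Ineq137Torus.T P 0 x y < (P.L : ℝ) ^ k → y ∈ B) →
          ∀ (f : Balaban1983to89.Site P 0 → ℂ) (F D : ℝ), (∀ y, ‖f y‖ ≤ F) → 0 ≤ D →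
          (∀ y, f y ≠ 0 → D ≤ B5Ineq137Torus.T P 0 x y) → ∀ (μ : Fin P.d),
          ‖covD P.eps⁻¹ (cfg U) (gBox (B1RG242Torus.α P a k * (P.L : ℝ) ^ (k * P.d)) P.eps⁻¹ U k Ω *ᵥ f) ⟨x, μ⟩‖ ≤
            P.spacing k * (c₀ * Real.exp (-(δ₀ * (((P.L : ℝ) ^ k)⁻¹ * D))) * F)) := by
  obtain ⟨δv, cv, hδv, hcv, HV⟩ := decay110_smallPlaquette_region_uniform d ℓ hd3 hℓ ha
  obtain ⟨td, cd, htd, hcd, HD⟩ := decay110_smallPlaquette_region_deriv_uniform_input d (ℓ + 1) hd1 hd3 ⟨hodd, by omega⟩ ha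
  refine ⟨max cv cd, min δv td, hcv.le.trans (le_max_left _ _), lt_min hδv htd, ?_⟩
  intro P hPd hPL k hk1 hkK hbig U θ hθ0 hθ hτ B Ω hB hΩ hsub
  have hkm : k ≤ P.m + P.K := hkK.trans (Nat.le_add_left _ _)
  have hLr : (1 : ℝ) ≤ (P.L : ℝ) ^ k := one_le_pow₀ (B1RG242Torus.one_lt_cast_L P).le
  have hPk : (0 : ℝ) < (P.L : ℝ) ^ k := pow_pos P.cast_L_pos k
  have hdr : (P.d : ℝ) = (d : ℝ) + 1 := by rw [hPd]; push_cast; ring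
  have hd1r : (1 : ℝ) ≤ P.d := by rw [hdr]; linarith [(Nat.cast_nonneg d : (0 : ℝ) ≤ d)]
  have hd3r : (P.d : ℝ) ≤ 3 := by rw [hPd]; exact_mod_cast hd3
  obtain ⟨hsm1, hsm2⟩ := threshold_smallness hd1r hd3r hLr hθ0 hτ
  have hsk2 : 0 ≤ P.spacing k ^ 2 := sq_nonneg _
  have hsk : 0 ≤ P.spacing k := (P.spacing_pos k).le
  have hplaq : ∀ p : Balaban1983to89.Plaq P 0, ‖toC (GaugeField.plaqHol U p) - 1‖ ≤ θ := by
    rintro ⟨y, μ, ν, hμν⟩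
    rw [← plaqC_eq_toC_plaqHol U y hμν]; exact hθ y μ ν
  have hT : ((P.d - 1 : ℕ) : ℝ) * ((P.L : ℝ) ^ k - 1) * θ ≤ ((P.d : ℝ) - 1) * ((P.L : ℝ) ^ k - 1) * θ := by
    rw [Nat.cast_sub P.hd, Nat.cast_one]
  -- the value member of a block union `X`, at the common constants
  have hval : ∀ X : Finset (Balaban1983to89.Site P 0), IsBlockUnion k X →
      ∀ (x : Balaban1983to89.Site P 0) (f : Balaban1983to89.Site P 0 → ℂ) (F D : ℝ), (∀ y, ‖f y‖ ≤ F) → 0 ≤ D →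
      (∀ y, f y ≠ 0 → D ≤ B5Ineq137Torus.T P 0 x y) →
      ‖(gBox (B1RG242Torus.α P a k * (P.L : ℝ) ^ (k * P.d)) P.eps⁻¹ U k X *ᵥ f) x‖ ≤
        P.spacing k ^ 2 * (max cv cd * Real.exp (-(min δv td * (((P.L : ℝ) ^ k)⁻¹ * D))) * F) := by
    intro X hX x f F D hF hD hsupp
    have hF0 : 0 ≤ F := (norm_nonneg _).trans (hF x)
    refine (HV P hPd hPL k hk1 hkm hbig U θ hθ0 hplaq _ hT hsm2 X hX x f F D hF hsupp).trans ?_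
    exact mul_le_mul_of_nonneg_left (mono_bound hcv.le (le_max_left _ _) (min_le_left _ _) (mul_nonneg (inv_pos.2 hPk).le hD) hF0) hsk2
  -- the covariant-derivative member of a block union `X`, at the common constants
  have hder : ∀ X : Finset (Balaban1983to89.Site P 0), IsBlockUnion k X →
      ∀ (x : Balaban1983to89.Site P 0), (∀ y, B5Ineq137Torus.T P 0 x y < (P.L : ℝ) ^ k → y ∈ X) →
      ∀ (f : Balaban1983to89.Site P 0 → ℂ) (F D : ℝ), (∀ y, ‖f y‖ ≤ F) → 0 ≤ D → (∀ y, f y ≠ 0 → D ≤ B5Ineq137Torus.T P 0 x y) →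
      ∀ (μ : Fin P.d), ‖covD P.eps⁻¹ (cfg U) (gBox (B1RG242Torus.α P a k * (P.L : ℝ) ^ (k * P.d)) P.eps⁻¹ U k X *ᵥ f) ⟨x, μ⟩‖ ≤
        P.spacing k * (max cv cd * Real.exp (-(min δv td * (((P.L : ℝ) ^ k)⁻¹ * D))) * F) := by
    intro X hX x hball f F D hF hD hsupp μ
    have hF0 : 0 ≤ F := (norm_nonneg _).trans (hF x)
    refine (HD P hPd hPL k hk1 hkK hbig U θ hθ0 hplaq hsm1 _ hT hsm2 X hX x hball f F D hF hsupp μ).trans ?_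
    exact mul_le_mul_of_nonneg_left (mono_bound hcd.le (le_max_right _ _) (min_le_right _ _) (mul_nonneg (inv_pos.2 hPk).le hD) hF0) hsk
  exact ⟨hsm1, fun x _ f F D hF hD hsupp => hval B hB x f F D hF hD hsupp, fun x _ f F D hF hD hsupp => hval Ω hΩ x f F D hF hD hsupp,
    fun x hball f F D hF hD hsupp μ => hder B hB x hball f F D hF hD hsupp μ,
    fun x hball f F D hF hD hsupp μ => hder Ω hΩ x (fun y hy => hsub (hball y hy)) f F D hF hD hsupp μ⟩

/-! ## §3 The value member for nested block unions, hypothesis-free, every row -/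

/-- **[Balaban1983RegularityDecay] (1.11)–(1.12), VALUE MEMBER, FOR GENERAL NESTED `k`-BLOCK UNIONS `□ ⊆ Ω` AT A SMALL-PLAQUETTE `U(1)`
FIELD, HYPOTHESIS-FREE, AT EVERY ROW `x ∈ □`**: for `1 ≤ d`, `d + 1 ≤ 3`, `ℓ ≥ 1` with `ℓ + 1` odd, `a > 0` there are `c, δ > 0` such that
for every volume (`P.d = d + 1`, `P.L = ℓ + 1`), every `1 ≤ k ≤ K` with `2(L^k − 1) + 4 < |T|`, every `u` with `‖u(∂p) − 1‖ ≤ θ`, `0 ≤ θ`,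
`((L^k)²θ)² ≤ 1/500`, all nested `k`-block unions `□ ⊆ Ω`, EVERY row `x ∈ □` and every `f` supported in `□` (`‖f‖_∞ ≤ F`,
`D ≤ dist(x, supp f)`, `D_b ≤ dist(x, □^c)`, `D_f ≤ dist(supp f, □^c)`):
`‖(G_k(□,u)f)(x) − (G_k(Ω,u)f)(x)‖ ≤ (L^kε)²·c e^{−δD/L^k}e^{−δ(D_b + D_f)/L^k}·F`.
[cite: Balaban1983RegularityDecay, Theorem p.573 (1.11)–(1.12)] [cite: BalabanImbrieJaffe1985, (7.3.1) p.326] -/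
theorem close112_smallPlaquette_region (d ℓ : ℕ) (hd1 : 1 ≤ d) (hd3 : d + 1 ≤ 3) (hℓ : 1 ≤ ℓ) (hodd : Odd (ℓ + 1)) {a : ℝ} (ha : 0 < a) :
    ∃ c δ : ℝ, 0 < c ∧ 0 < δ ∧ ∀ (P : Params), P.d = d + 1 → P.L = ℓ + 1 →
      ∀ k : ℕ, 1 ≤ k → k ≤ P.K → 2 * (P.L ^ k - 1) + 4 < P.sitesPerDir 0 →
      ∀ (U : GaugeField P 0 U1) (θ : ℝ), 0 ≤ θ → (∀ (y : Balaban1983to89.Site P 0) (μ ν : Fin P.d), ‖plaqC U y μ ν - 1‖ ≤ θ) →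
        (((P.L : ℝ) ^ k) ^ 2 * θ) ^ 2 ≤ 1 / 500 →
      ∀ (B Ω : Finset (Balaban1983to89.Site P 0)), IsBlockUnion k B → IsBlockUnion k Ω → B ⊆ Ω →
      ∀ x ∈ B, ∀ (f : Balaban1983to89.Site P 0 → ℂ) (F D Db Df : ℝ), (∀ y, ‖f y‖ ≤ F) → (∀ y, y ∉ B → f y = 0) →
        0 ≤ D → (∀ y, f y ≠ 0 → D ≤ B5Ineq137Torus.T P 0 x y) → 0 ≤ Db → (∀ w, w ∉ B → Db ≤ B5Ineq137Torus.T P 0 x w) →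
        0 ≤ Df → (∀ y, f y ≠ 0 → ∀ w, w ∉ B → Df ≤ B5Ineq137Torus.T P 0 y w) →
        ‖(gBox (B1RG242Torus.α P a k * (P.L : ℝ) ^ (k * P.d)) P.eps⁻¹ U k B *ᵥ f) x -
            (gBox (B1RG242Torus.α P a k * (P.L : ℝ) ^ (k * P.d)) P.eps⁻¹ U k Ω *ᵥ f) x‖ ≤
          P.spacing k ^ 2 * (c * Real.exp (-(δ * (((P.L : ℝ) ^ k)⁻¹ * D))) *
            Real.exp (-(δ * (((P.L : ℝ) ^ k)⁻¹ * (Db + Df)))) * F) := by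
  obtain ⟨c₀, δ₀, hc₀, hδ₀, HI⟩ := inputs110_smallPlaquette_region d ℓ hd1 hd3 hℓ hodd ha
  obtain ⟨c₁, δ₁, hc₁, hδ₁, HC⟩ := close112_smallField_of_inputs_allRows (d + 1) (ℓ + 1) (by omega) hd3 ⟨hodd, by omega⟩ ha hc₀ hδ₀
  refine ⟨c₁, δ₁, hc₁, hδ₁, ?_⟩
  intro P hPd hPL k hk1 hkK hbig U θ hθ0 hθ hτ B Ω hB hΩ hsub x hx f F D Db Df hF hfB hD hsD hDb hsDb hDf hsDf
  obtain ⟨hsm1, hGB, hGΩ, -, -⟩ := HI P hPd hPL k hk1 hkK hbig U θ hθ0 hθ hτ B Ω hB hΩ hsub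
  exact HC P hPd hPL k hk1 hkK U θ hθ hsm1 B Ω hB hΩ hsub hGB hGΩ x hx f F D Db Df hF hfB hD hsD hDb hsDb hDf hsDf

/-! ## §4 The covariant-derivative member for nested block unions, hypothesis-free, rows whose open `L^k`-ball lies in `□` -/

/-- **[Balaban1983RegularityDecay] (1.11)–(1.12), COVARIANT-DERIVATIVE MEMBER, FOR GENERAL NESTED `k`-BLOCK UNIONS `□ ⊆ Ω` AT A
SMALL-PLAQUETTE `U(1)` FIELD, HYPOTHESIS-FREE**: same data as `close112_smallPlaquette_region`, rows `x ∈ □` with `L^k ≤ T(x, w)` for every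
`w ∉ □`, every `μ`:  `‖covD ε⁻¹ u (G_k(□,u)f) ⟨x,μ⟩ − covD ε⁻¹ u (G_k(Ω,u)f) ⟨x,μ⟩‖ ≤ (L^kε)·c e^{−δD/L^k}e^{−δ(D_b + D_f)/L^k}·F`.
[cite: Balaban1983RegularityDecay, Theorem p.573 (1.10)–(1.12)] [cite: BalabanImbrieJaffe1985, (7.3.1) p.326] -/
theorem close112_smallPlaquette_region_deriv (d ℓ : ℕ) (hd1 : 1 ≤ d) (hd3 : d + 1 ≤ 3) (hℓ : 1 ≤ ℓ) (hodd : Odd (ℓ + 1)) {a : ℝ}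
    (ha : 0 < a) :
    ∃ c δ : ℝ, 0 < c ∧ 0 < δ ∧ ∀ (P : Params), P.d = d + 1 → P.L = ℓ + 1 →
      ∀ k : ℕ, 1 ≤ k → k ≤ P.K → 2 * (P.L ^ k - 1) + 4 < P.sitesPerDir 0 →
      ∀ (U : GaugeField P 0 U1) (θ : ℝ), 0 ≤ θ → (∀ (y : Balaban1983to89.Site P 0) (μ ν : Fin P.d), ‖plaqC U y μ ν - 1‖ ≤ θ) →
        (((P.L : ℝ) ^ k) ^ 2 * θ) ^ 2 ≤ 1 / 500 →
      ∀ (B Ω : Finset (Balaban1983to89.Site P 0)), IsBlockUnion k B → IsBlockUnion k Ω → B ⊆ Ω →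
      ∀ x ∈ B, (∀ w, w ∉ B → (P.L : ℝ) ^ k ≤ B5Ineq137Torus.T P 0 x w) →
      ∀ (f : Balaban1983to89.Site P 0 → ℂ) (F D Db Df : ℝ), (∀ y, ‖f y‖ ≤ F) → (∀ y, y ∉ B → f y = 0) →
        0 ≤ D → (∀ y, f y ≠ 0 → D ≤ B5Ineq137Torus.T P 0 x y) → 0 ≤ Db → (∀ w, w ∉ B → Db ≤ B5Ineq137Torus.T P 0 x w) →
        0 ≤ Df → (∀ y, f y ≠ 0 → ∀ w, w ∉ B → Df ≤ B5Ineq137Torus.T P 0 y w) → ∀ (μ : Fin P.d),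
        ‖covD P.eps⁻¹ (cfg U) (gBox (B1RG242Torus.α P a k * (P.L : ℝ) ^ (k * P.d)) P.eps⁻¹ U k B *ᵥ f) ⟨x, μ⟩ -
            covD P.eps⁻¹ (cfg U) (gBox (B1RG242Torus.α P a k * (P.L : ℝ) ^ (k * P.d)) P.eps⁻¹ U k Ω *ᵥ f) ⟨x, μ⟩‖ ≤
          P.spacing k * (c * Real.exp (-(δ * (((P.L : ℝ) ^ k)⁻¹ * D))) *
            Real.exp (-(δ * (((P.L : ℝ) ^ k)⁻¹ * (Db + Df)))) * F) := by
  obtain ⟨c₀, δ₀, hc₀, hδ₀, HI⟩ := inputs110_smallPlaquette_region d ℓ hd1 hd3 hℓ hodd ha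
  obtain ⟨c₂, δ₂, hc₂, hδ₂, HC⟩ := close112_smallField_deriv_of_inputs_ballRows (d + 1) (ℓ + 1) (by omega) hd3 ⟨hodd, by omega⟩ ha hc₀ hδ₀
  refine ⟨c₂, δ₂, hc₂, hδ₂, ?_⟩
  intro P hPd hPL k hk1 hkK hbig U θ hθ0 hθ hτ B Ω hB hΩ hsub x hx hrow f F D Db Df hF hfB hD hsD hDb hsDb hDf hsDf μ
  obtain ⟨hsm1, hGB, hGΩ, hDB, hDΩ⟩ := HI P hPd hPL k hk1 hkK hbig U θ hθ0 hθ hτ B Ω hB hΩ hsub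
  exact HC P hPd hPL k hk1 hkK U θ hθ hsm1 B Ω hB hΩ hsub hGB hGΩ hDB hDΩ x hx hrow f F D Db Df hF hfB hD hsD hDb hsDb hDf hsDf μ

/-! ## §5 The consumer shape `hC` (+ `hGΩ`) of p31's `opClose231_gen` for a family of block unions inside a general block union -/

/-- **THE (H1.12″) AND (H1.10″) INPUTS OF p31's `BIJ88DeltaLocClose235General.opClose231_gen` FOR A GENERAL REGION `Ω`, HYPOTHESIS-FREE**:
for `1 ≤ d`, `d + 1 ≤ 3`, `ℓ ≥ 1` with `ℓ + 1` odd, `a > 0` there are `c, δ > 0` such that for every volume, `1 ≤ k ≤ K`,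
`2(L^k − 1) + 4 < |T|`, every `u` with `‖u(∂p) − 1‖ ≤ θ`, `0 ≤ θ`, `((L^k)²θ)² ≤ 1/500`, every `k`-block union `Ω` and every family of
`k`-block unions `□_α ⊆ Ω` (our reading of p. 263 *"for (2.31) we assume smoothness throughout the subset Ω ⊂ T_η"*: `Ω` a union of
`k`-blocks containing the cubes `□_α` of (2.27)):
(hGΩ) `‖(G_k(Ω,u)f)(x)‖ ≤ (L^kε)²c e^{−δD/L^k}F` at every `x`, and (hC) at every row `x ∈ □_α`, every `f` supported in `□_α`:
`‖(G_k(□_α,u)f)(x) − (G_k(Ω,u)f)(x)‖ ≤ (L^kε)²·c e^{−δD/L^k}e^{−δ(D_b + D_f)/L^k}·F` — the binders `hGΩ` (with `X₀ = univ`) and `hC`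
(with `Xr α = □_α`) of `opClose231_gen` verbatim.
[cite: Balaban1983RegularityDecay, Theorem p.573 (1.10)–(1.12)] [cite: BalabanImbrieJaffe1988, (2.31) p.263] -/
theorem close112_smallPlaquette_region_hC (d ℓ : ℕ) (hd1 : 1 ≤ d) (hd3 : d + 1 ≤ 3) (hℓ : 1 ≤ ℓ) (hodd : Odd (ℓ + 1)) {a : ℝ}
    (ha : 0 < a) :
    ∃ c δ : ℝ, 0 < c ∧ 0 < δ ∧ ∀ (P : Params), P.d = d + 1 → P.L = ℓ + 1 →
      ∀ k : ℕ, 1 ≤ k → k ≤ P.K → 2 * (P.L ^ k - 1) + 4 < P.sitesPerDir 0 →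
      ∀ (U : GaugeField P 0 U1) (θ : ℝ), 0 ≤ θ → (∀ (y : Balaban1983to89.Site P 0) (μ ν : Fin P.d), ‖plaqC U y μ ν - 1‖ ≤ θ) →
        (((P.L : ℝ) ^ k) ^ 2 * θ) ^ 2 ≤ 1 / 500 →
      ∀ (Ω : Finset (Balaban1983to89.Site P 0)) {ι : Type*} (cube : ι → Finset (Balaban1983to89.Site P 0)),
      IsBlockUnion k Ω → (∀ α, IsBlockUnion k (cube α)) → (∀ α, cube α ⊆ Ω) →
      (∀ x ∈ (univ : Finset (Balaban1983to89.Site P 0)), ∀ (f : Balaban1983to89.Site P 0 → ℂ) (F D : ℝ), (∀ y, ‖f y‖ ≤ F) → 0 ≤ D →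
          (∀ y, f y ≠ 0 → D ≤ B5Ineq137Torus.T P 0 x y) →
          ‖(gBox (B1RG242Torus.α P a k * (P.L : ℝ) ^ (k * P.d)) P.eps⁻¹ U k Ω *ᵥ f) x‖ ≤
            P.spacing k ^ 2 * (c * Real.exp (-(δ * (((P.L : ℝ) ^ k)⁻¹ * D))) * F)) ∧
      (∀ α, ∀ x ∈ cube α, ∀ (f : Balaban1983to89.Site P 0 → ℂ) (F D Db Df : ℝ), (∀ y, ‖f y‖ ≤ F) → (∀ y, y ∉ cube α → f y = 0) →
        0 ≤ D → (∀ y, f y ≠ 0 → D ≤ B5Ineq137Torus.T P 0 x y) → 0 ≤ Db → (∀ w, w ∉ cube α → Db ≤ B5Ineq137Torus.T P 0 x w) →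
        0 ≤ Df → (∀ y, f y ≠ 0 → ∀ w, w ∉ cube α → Df ≤ B5Ineq137Torus.T P 0 y w) →
        ‖(gBox (B1RG242Torus.α P a k * (P.L : ℝ) ^ (k * P.d)) P.eps⁻¹ U k (cube α) *ᵥ f) x -
            (gBox (B1RG242Torus.α P a k * (P.L : ℝ) ^ (k * P.d)) P.eps⁻¹ U k Ω *ᵥ f) x‖ ≤
          P.spacing k ^ 2 * (c * Real.exp (-(δ * (((P.L : ℝ) ^ k)⁻¹ * D))) *
            Real.exp (-(δ * (((P.L : ℝ) ^ k)⁻¹ * (Db + Df)))) * F)) := by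
  obtain ⟨δv, cv, hδv, hcv, HV⟩ := decay110_smallPlaquette_region_uniform d ℓ hd3 hℓ ha
  obtain ⟨c₁, δ₁, hc₁, hδ₁, HC⟩ := close112_smallField_hC_allRows (d + 1) (ℓ + 1) (by omega) hd3 ⟨hodd, by omega⟩ ha hcv.le hδv
  refine ⟨max cv c₁, min δv δ₁, lt_max_of_lt_left hcv, lt_min hδv hδ₁, ?_⟩
  intro P hPd hPL k hk1 hkK hbig U θ hθ0 hθ hτ Ω ι cube hΩ hcube hsub
  have hkm : k ≤ P.m + P.K := hkK.trans (Nat.le_add_left _ _)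
  have hLr : (1 : ℝ) ≤ (P.L : ℝ) ^ k := one_le_pow₀ (B1RG242Torus.one_lt_cast_L P).le
  have hPk : (0 : ℝ) < (P.L : ℝ) ^ k := pow_pos P.cast_L_pos k
  have hdr : (P.d : ℝ) = (d : ℝ) + 1 := by rw [hPd]; push_cast; ring
  have hd1r : (1 : ℝ) ≤ P.d := by rw [hdr]; linarith [(Nat.cast_nonneg d : (0 : ℝ) ≤ d)]
  have hd3r : (P.d : ℝ) ≤ 3 := by rw [hPd]; exact_mod_cast hd3
  obtain ⟨hsm1, hsm2⟩ := threshold_smallness hd1r hd3r hLr hθ0 hτ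
  have hsk2 : 0 ≤ P.spacing k ^ 2 := sq_nonneg _
  have hplaq : ∀ p : Balaban1983to89.Plaq P 0, ‖toC (GaugeField.plaqHol U p) - 1‖ ≤ θ := by
    rintro ⟨y, μ, ν, hμν⟩
    rw [← plaqC_eq_toC_plaqHol U y hμν]; exact hθ y μ ν
  have hT : ((P.d - 1 : ℕ) : ℝ) * ((P.L : ℝ) ^ k - 1) * θ ≤ ((P.d : ℝ) - 1) * ((P.L : ℝ) ^ k - 1) * θ := by
    rw [Nat.cast_sub P.hd, Nat.cast_one]
  -- p34's value member for any block union `X`, at its own constants `(cv, δv)`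
  have hval : ∀ X : Finset (Balaban1983to89.Site P 0), IsBlockUnion k X →
      ∀ (x : Balaban1983to89.Site P 0) (f : Balaban1983to89.Site P 0 → ℂ) (F D : ℝ), (∀ y, ‖f y‖ ≤ F) → 0 ≤ D →
      (∀ y, f y ≠ 0 → D ≤ B5Ineq137Torus.T P 0 x y) →
      ‖(gBox (B1RG242Torus.α P a k * (P.L : ℝ) ^ (k * P.d)) P.eps⁻¹ U k X *ᵥ f) x‖ ≤
        P.spacing k ^ 2 * (cv * Real.exp (-(δv * (((P.L : ℝ) ^ k)⁻¹ * D))) * F) :=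
    fun X hX x f F D hF _ hsupp => HV P hPd hPL k hk1 hkm hbig U θ hθ0 hplaq _ hT hsm2 X hX x f F D hF hsupp
  refine ⟨fun x _ f F D hF hD hsupp => ?_, fun α x hx f F D Db Df hF hfB hD hsD hDb hsDb hDf hsDf => ?_⟩
  · have hF0 : 0 ≤ F := (norm_nonneg _).trans (hF x)
    refine (hval Ω hΩ x f F D hF hD hsupp).trans ?_
    exact mul_le_mul_of_nonneg_left (mono_bound hcv.le (le_max_left _ _) (min_le_left _ _) (mul_nonneg (inv_pos.2 hPk).le hD) hF0) hsk2
  · have hF0 : 0 ≤ F := (norm_nonneg _).trans (hF x)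
    have hE1 : 0 ≤ ((P.L : ℝ) ^ k)⁻¹ * D := mul_nonneg (inv_pos.2 hPk).le hD
    have hE2 : 0 ≤ ((P.L : ℝ) ^ k)⁻¹ * (Db + Df) := mul_nonneg (inv_pos.2 hPk).le (add_nonneg hDb hDf)
    have h := HC P hPd hPL k hk1 hkK U θ hθ hsm1 Ω cube hΩ hcube hsub (fun α x _ f F D hF hD hsupp => hval (cube α) (hcube α) x f F D hF hD hsupp)
      (fun α x _ f F D hF hD hsupp => hval Ω hΩ x f F D hF hD hsupp) α x hx f F D Db Df hF hfB hD hsD hDb hsDb hDf hsDf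
    refine h.trans (mul_le_mul_of_nonneg_left ?_ hsk2)
    have h1 : Real.exp (-(δ₁ * (((P.L : ℝ) ^ k)⁻¹ * D))) ≤ Real.exp (-(min δv δ₁ * (((P.L : ℝ) ^ k)⁻¹ * D))) :=
      Real.exp_le_exp.2 (neg_le_neg (mul_le_mul_of_nonneg_right (min_le_right _ _) hE1))
    have h2 : Real.exp (-(δ₁ * (((P.L : ℝ) ^ k)⁻¹ * (Db + Df)))) ≤ Real.exp (-(min δv δ₁ * (((P.L : ℝ) ^ k)⁻¹ * (Db + Df)))) :=
      Real.exp_le_exp.2 (neg_le_neg (mul_le_mul_of_nonneg_right (min_le_right _ _) hE2))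
    have h3 : c₁ * Real.exp (-(δ₁ * (((P.L : ℝ) ^ k)⁻¹ * D))) ≤ max cv c₁ * Real.exp (-(min δv δ₁ * (((P.L : ℝ) ^ k)⁻¹ * D))) :=
      mul_le_mul (le_max_right _ _) h1 (Real.exp_pos _).le (hcv.le.trans (le_max_left _ _))
    exact mul_le_mul_of_nonneg_right (mul_le_mul h3 h2 (Real.exp_pos _).le
      (mul_nonneg (hcv.le.trans (le_max_left _ _)) (Real.exp_pos _).le)) hF0

end

end Literature.MathematicalPhysics.QuantumFieldTheory.BalabanImbrieJaffe1984to88.BIJ88NeumannPropagatorSmallFieldCloseRegion
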